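import Summits.QuantumAdvantage.QuantumAdvantage.Theorems.LinnikCubicClassGroupsDegreeOnePrimesEscapeShortInterval
import HarnessLib

/-!
# Prime ideals of a class in short intervals, V: from prime powers to prime ideals

Topic `Summits/QuantumAdvantage/QuantumAdvantage/Theorems`, cell B2b-1 (linnik-cubic), PART A (gen 5);
helper for the crux `DegreeOnePrimesEscape` (stmt-QuantumAdvantage-11543) of route
`LinnikCubicClassGroups`.  HONEST FRAMING: the value of this file is a THEOREM (kernel-checked, GRH-free,
Siegel-free) — NOT summit progress.

File IV (`classPsi_shortInterval_of_odd`) counts prime-power ideals with the von Mangoldt weight.  Since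
`ψ_C(y) − θ_C(y) ≤ 2n√y log y` (`classPsi_sub_theta_le_sqrt`), the prime powers are negligible against
`h ≥ x^{1−δ}` (`δ ≤ 1/4`, one more absorption), whence for every number field `K` of ODD degree `n`,
every class `C`, every `x ≥ Q^{a₀}` and `x^{1−δ} ≤ h ≤ x`:

* `theta_shortInterval_of_odd` — `Σ_{𝔭 ∈ C prime, x < N𝔭 ≤ x+h} log N𝔭 = θ_C(x+h) − θ_C(x) ≥ h/(16 h_K)`;
* `exists_prime_mem_class_absNorm_mem_Ioc_of_odd` — **every ideal class contains a PRIME IDEAL with norm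
  in every short interval `(x, x + h]`** (`x ≥ Q^{a₀}`, `x^{1−δ} ≤ h ≤ x`); the cubic cases
  `theta_shortInterval_cubic`, `exists_prime_mem_class_absNorm_mem_Ioc_cubic`.

This is the short-interval refinement of the cell's Linnik theorem `exists_prime_mem_class_absNorm_le`
(`…LeastPrimeIdeal.lean`, every degree, one prime of norm `≤ Q^L`) in odd degree.
-/

noncomputable section

open Complex Real MeasureTheory Set Filter Topology
open scoped NumberField nonZeroDivisors

namespace Summit.QuantumAdvantage.QuantumAdvantage.Theorems.DegreeOnePrimesEscape

open Literature.NumberTheory.LFunctions Literature.NumberTheory.LFunctions.NumberField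
  Literature.NumberTheory.LFunctions.AbelianDensity

variable {K : Type} [Field K] [NumberField K]

/-! ### `θ_C` over a short interval and the existence of a prime ideal -/

/-- `θ_C(x+h) − θ_C(x) = Σ_{⌊x⌋ < n ≤ ⌊x+h⌋} #{𝔭 ∈ C : N𝔭 = n} · log n` (`h ≥ 0`). [folklore] -/
theorem chebyshevThetaIdealClass_sub_eq_sum (C : ClassGroup (𝓞 K)) {x h : ℝ} (hh : 0 ≤ h) :
    chebyshevThetaIdealClass K C (x + h) - chebyshevThetaIdealClass K C x =
      ∑ n ∈ Finset.Ioc ⌊x⌋₊ ⌊x + h⌋₊, (normPrimeIdealClassCount K C n : ℝ) * Real.log n := by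
  unfold chebyshevThetaIdealClass
  have hsub : Finset.Icc 0 ⌊x⌋₊ ⊆ Finset.Icc 0 ⌊x + h⌋₊ :=
    Finset.Icc_subset_Icc le_rfl (Nat.floor_le_floor (by linarith))
  rw [← Finset.sum_sdiff hsub]
  have hsd : Finset.Icc 0 ⌊x + h⌋₊ \ Finset.Icc 0 ⌊x⌋₊ = Finset.Ioc ⌊x⌋₊ ⌊x + h⌋₊ := by
    ext n; simp only [Finset.mem_sdiff, Finset.mem_Icc, Finset.mem_Ioc]; omega
  rw [hsd]; ring

/-- **A positive `θ_C`-increment over `(x, x+h]` produces a prime ideal of `C` with norm in `(x, x+h]`**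
(`x ≥ 1`, `h ≥ 0`). [folklore] -/
theorem exists_prime_of_theta_sub_pos (C : ClassGroup (𝓞 K)) {x h : ℝ} (hx : 1 ≤ x) (hh : 0 ≤ h)
    (hpos : 0 < chebyshevThetaIdealClass K C (x + h) - chebyshevThetaIdealClass K C x) :
    ∃ P : Ideal (𝓞 K), P.IsPrime ∧ x < (Ideal.absNorm P : ℝ) ∧ (Ideal.absNorm P : ℝ) ≤ x + h ∧
      ∃ hP : P ∈ (Ideal (𝓞 K))⁰, ClassGroup.mk0 ⟨P, hP⟩ = C := by
  classical
  rw [chebyshevThetaIdealClass_sub_eq_sum C hh] at hpos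
  obtain ⟨n, hn, hne⟩ := Finset.exists_ne_zero_of_sum_ne_zero hpos.ne'
  have hcount : normPrimeIdealClassCount K C n ≠ 0 := by
    intro h0; rw [h0] at hne; simp at hne
  obtain ⟨P, hP⟩ := Set.nonempty_of_ncard_ne_zero hcount
  obtain ⟨hPprime, hPn, hP0, hPC⟩ := hP
  obtain ⟨h1, h2⟩ := log_natCast_mem_of_mem_Ioc hx hn
  have hn0 : (0 : ℝ) < n := by
    rw [Finset.mem_Ioc] at hn
    exact_mod_cast (Nat.lt_of_le_of_lt (Nat.zero_le _) hn.1)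
  refine ⟨P, hPprime, ?_, ?_, hP0, hPC⟩
  · rw [hPn]
    exact (Real.log_lt_log_iff (by linarith) hn0).1 h1
  · rw [hPn]
    exact (Real.log_le_log_iff hn0 (by linarith)).1 h2

/-! ### The prime powers are negligible -/

/-- **`θ_C` in short intervals, every number field of ODD degree.**  For odd `n > 1` there are
`δ, a₀ > 0` such that for every number field `K` of degree `n`, every class `C`, every `x ≥ Q^{a₀}` and
`x^{1−δ} ≤ h ≤ x`:  `h/(16 h_K) ≤ θ_C(x+h) − θ_C(x) = Σ_{𝔭 ∈ C prime, x < N𝔭 ≤ x+h} log N𝔭`. -/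
theorem theta_shortInterval_of_odd (n : ℕ) (hn : 1 < n) (hodd : Odd n) :
    ∃ δ a₀ : ℝ, 0 < δ ∧ 0 < a₀ ∧ ∀ (K : Type) [Field K] [NumberField K], Module.finrank ℚ K = n →
      ∀ (C : ClassGroup (𝓞 K)) (x h : ℝ), ThornerZaman.condQn K ^ a₀ ≤ x → x ^ (1 - δ) ≤ h → h ≤ x →
        h / (16 * (NumberField.classNumber K : ℝ)) ≤
          chebyshevThetaIdealClass K C (x + h) - chebyshevThetaIdealClass K C x := by
  obtain ⟨δ, a₀, hδ, ha₀, hmain⟩ := classPsi_shortInterval_of_odd n hn hodd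
  obtain ⟨a₂, ha₂, habs⟩ := absorb_junk 64 1 (by norm_num) one_pos le_rfl
  set δ' : ℝ := min δ (1 / 4) with hδ'
  have hδ'0 : 0 < δ' := lt_min hδ (by norm_num)
  have hδ'δ : δ' ≤ δ := min_le_left _ _
  have hδ'4 : δ' ≤ 1 / 4 := min_le_right _ _
  refine ⟨δ', max a₀ a₂, hδ'0, lt_max_of_lt_left ha₀, fun K _ _ hKn C x h hx hhx hhx' ↦ ?_⟩
  have hK : 1 < Module.finrank ℚ K := by rw [hKn]; exact hn
  set Q : ℝ := ThornerZaman.condQn K with hQ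
  have hQ12 : (12 : ℝ) ≤ Q := ThornerZaman.twelve_le_condQn (K := K) hK
  have hQ1 : (1 : ℝ) ≤ Q := by linarith
  have hxa₀ : Q ^ a₀ ≤ x := (Real.rpow_le_rpow_of_exponent_le hQ1 (le_max_left _ _)).trans hx
  have hxa₂ : Q ^ a₂ ≤ x := (Real.rpow_le_rpow_of_exponent_le hQ1 (le_max_right _ _)).trans hx
  have hQx : Q ≤ x := by
    have := (Real.rpow_le_rpow_of_exponent_le hQ1 (ha₂.trans (le_max_right a₀ a₂))).trans hx
    rwa [Real.rpow_one] at this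
  have hx1 : 1 ≤ x := by linarith
  have hx0 : 0 < x := by linarith
  -- `x^{1−δ} ≤ x^{1−δ'} ≤ h`
  have hhxδ : x ^ (1 - δ) ≤ h := (Real.rpow_le_rpow_of_exponent_le hx1 (by linarith)).trans hhx
  obtain ⟨hlow, -⟩ := hmain K hKn C x h hxa₀ hhxδ hhx'
  have hh0 : 0 < h := lt_of_lt_of_le (Real.rpow_pos_of_pos hx0 _) hhx
  -- the prime powers: `ψ_C(x+h) − θ_C(x+h) ≤ 2n √(x+h) log(x+h) ≤ h/(16 h_K)`
  have hnQ : (Module.finrank ℚ K : ℝ) ≤ Q := ThornerZaman.finrank_le_condQn (K := K)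
  have hhK : (NumberField.classNumber K : ℝ) ≤ Q ^ (4 : ℕ) := ThornerZaman.classNumber_le_condQn_pow (K := K) hK
  have hh1 : (1 : ℝ) ≤ (NumberField.classNumber K : ℝ) := by exact_mod_cast one_le_classNumber (K := K)
  have hpp := classPsi_sub_theta_le_sqrt (K := K) C (show (1 : ℝ) ≤ x + h by linarith)
  have hθψ := chebyshevThetaIdealClass_le_classPsi (K := K) C x
  -- sizes: `√(x+h) ≤ 2 x^{1/2}`, `log(x+h) ≤ log x + 1`, and the absorption `64 Q⁷ (log x + 1) x^{−1/4} ≤ 1`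
  have hsqrt : Real.sqrt (x + h) ≤ 2 * x ^ ((1 : ℝ) / 2) := by
    rw [Real.sqrt_eq_rpow]
    have h1 : (x + h) ^ ((1 : ℝ) / 2) ≤ (4 * x) ^ ((1 : ℝ) / 2) :=
      Real.rpow_le_rpow (by linarith) (by linarith) (by norm_num)
    have h2 : (4 * x) ^ ((1 : ℝ) / 2) = 2 * x ^ ((1 : ℝ) / 2) := by
      rw [Real.mul_rpow (by norm_num) hx0.le]
      congr 1
      rw [show (4 : ℝ) = 2 ^ (2 : ℕ) by norm_num, ← Real.rpow_natCast, ← Real.rpow_mul (by norm_num)]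
      norm_num
    linarith
  have hlogxh : Real.log (x + h) ≤ Real.log x + 1 := by
    have h1 : Real.log (x + h) ≤ Real.log (2 * x) := Real.log_le_log (by linarith) (by linarith)
    rw [Real.log_mul (by norm_num) hx0.ne'] at h1
    have h2 : Real.log 2 < 0.6931471808 := Real.log_two_lt_d9
    linarith
  have hlog0 : 0 ≤ Real.log (x + h) := Real.log_nonneg (by linarith)
  have habs' := habs Q x hQ12 hxa₂
  -- `2n√(x+h) log(x+h) · 16 h_K ≤ 64 Q⁷ (log x + 1) x^{1/2} ≤ x^{3/4} ≤ x^{1−δ'} ≤ h`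
  have hx34 : x ^ ((1 : ℝ) / 2) = x ^ (-((1 : ℝ) / 4)) * x ^ ((3 : ℝ) / 4) := by
    rw [← Real.rpow_add hx0]; norm_num
  have hkey : 2 * Module.finrank ℚ K * Real.sqrt (x + h) * Real.log (x + h) * (16 * (NumberField.classNumber K : ℝ)) ≤ h := by
    have hn0 : (0 : ℝ) ≤ Module.finrank ℚ K := Nat.cast_nonneg _
    have hQ57 : Q * Q ^ (4 : ℕ) ≤ Q ^ (7 : ℕ) := by
      rw [show Q * Q ^ (4 : ℕ) = Q ^ (5 : ℕ) by ring]; exact pow_le_pow_right₀ hQ1 (by norm_num)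
    calc 2 * Module.finrank ℚ K * Real.sqrt (x + h) * Real.log (x + h) * (16 * (NumberField.classNumber K : ℝ))
        ≤ 2 * Q * (2 * x ^ ((1 : ℝ) / 2)) * (Real.log x + 1) * (16 * Q ^ (4 : ℕ)) := by
          have hl1 : 0 ≤ Real.log x + 1 := by have := Real.log_nonneg hx1; linarith
          have hA' : 0 ≤ 2 * Q * (2 * x ^ ((1 : ℝ) / 2)) * (Real.log x + 1) := mul_nonneg (by positivity) hl1
          refine mul_le_mul (mul_le_mul (mul_le_mul (by linarith) hsqrt (Real.sqrt_nonneg _) (by positivity))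
            hlogxh hlog0 (by positivity)) (by linarith) (by positivity) hA'
      _ = 64 * (Q * Q ^ (4 : ℕ)) * (Real.log x + 1) * x ^ ((1 : ℝ) / 2) := by ring
      _ ≤ 64 * Q ^ (7 : ℕ) * (Real.log x + 1) * x ^ ((1 : ℝ) / 2) := by
          have h0 : 0 ≤ Real.log x + 1 := by have := Real.log_nonneg hx1; linarith
          have := mul_le_mul_of_nonneg_left hQ57 (by norm_num : (0 : ℝ) ≤ 64)
          exact mul_le_mul_of_nonneg_right (mul_le_mul_of_nonneg_right this h0) (by positivity)
      _ = (64 * Q ^ (7 : ℕ) * (Real.log x + 1) * x ^ (-((1 : ℝ) / 4))) * x ^ ((3 : ℝ) / 4) := by rw [hx34]; ring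
      _ ≤ 1 * x ^ ((3 : ℝ) / 4) := mul_le_mul_of_nonneg_right habs' (by positivity)
      _ ≤ x ^ (1 - δ') := by rw [one_mul]; exact Real.rpow_le_rpow_of_exponent_le hx1 (by linarith)
      _ ≤ h := hhx
  -- assemble
  have hh16 : h / (16 * (NumberField.classNumber K : ℝ)) =
      h / (8 * (NumberField.classNumber K : ℝ)) - h / (16 * (NumberField.classNumber K : ℝ)) := by
    field_simp; ring
  have hpp' : classPsi K C (x + h) - chebyshevThetaIdealClass K C (x + h) ≤ h / (16 * (NumberField.classNumber K : ℝ)) := by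
    rw [le_div_iff₀ (by positivity)]
    exact (mul_le_mul_of_nonneg_right hpp (by positivity)).trans hkey
  linarith [hpp', hθψ, hlow]

/-- **Every ideal class of every number field of ODD degree contains a prime ideal with norm in every
short interval `(x, x + h]`, `x ≥ Q^{a₀}`, `x^{1−δ} ≤ h ≤ x`** — unconditionally (GRH-free, Siegel-free). -/
theorem exists_prime_mem_class_absNorm_mem_Ioc_of_odd (n : ℕ) (hn : 1 < n) (hodd : Odd n) :
    ∃ δ a₀ : ℝ, 0 < δ ∧ 0 < a₀ ∧ ∀ (K : Type) [Field K] [NumberField K], Module.finrank ℚ K = n →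
      ∀ (C : ClassGroup (𝓞 K)) (x h : ℝ), ThornerZaman.condQn K ^ a₀ ≤ x → x ^ (1 - δ) ≤ h → h ≤ x →
        ∃ P : Ideal (𝓞 K), P.IsPrime ∧ x < (Ideal.absNorm P : ℝ) ∧ (Ideal.absNorm P : ℝ) ≤ x + h ∧
          ∃ hP : P ∈ (Ideal (𝓞 K))⁰, ClassGroup.mk0 ⟨P, hP⟩ = C := by
  obtain ⟨δ, a₀, hδ, ha₀, hmain⟩ := theta_shortInterval_of_odd n hn hodd
  refine ⟨δ, max a₀ 1, hδ, lt_max_of_lt_left ha₀, fun K _ _ hKn C x h hx hhx hhx' ↦ ?_⟩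
  have hK : 1 < Module.finrank ℚ K := by rw [hKn]; exact hn
  have hQ12 : (12 : ℝ) ≤ ThornerZaman.condQn K := ThornerZaman.twelve_le_condQn (K := K) hK
  have hQ1 : (1 : ℝ) ≤ ThornerZaman.condQn K := by linarith
  have hxa₀ : ThornerZaman.condQn K ^ a₀ ≤ x := (Real.rpow_le_rpow_of_exponent_le hQ1 (le_max_left _ _)).trans hx
  have hQx : ThornerZaman.condQn K ≤ x := by
    have := (Real.rpow_le_rpow_of_exponent_le hQ1 (le_max_right a₀ 1)).trans hx
    rwa [Real.rpow_one] at this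
  have hx1 : 1 ≤ x := by linarith
  have hx0 : 0 < x := by linarith
  have hh0 : 0 < h := lt_of_lt_of_le (Real.rpow_pos_of_pos hx0 _) hhx
  have hθ := hmain K hKn C x h hxa₀ hhx hhx'
  have hh1 : (1 : ℝ) ≤ (NumberField.classNumber K : ℝ) := by exact_mod_cast one_le_classNumber (K := K)
  have hpos : 0 < chebyshevThetaIdealClass K C (x + h) - chebyshevThetaIdealClass K C x :=
    lt_of_lt_of_le (by positivity) hθ
  exact exists_prime_of_theta_sub_pos C hx1 hh0.le hpos

/-- **Every cubic field**: `θ_C(x+h) − θ_C(x) ≥ h/(16 h_K)` for `x ≥ Q^{a₀}`, `x^{1−δ} ≤ h ≤ x`. -/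
theorem theta_shortInterval_cubic :
    ∃ δ a₀ : ℝ, 0 < δ ∧ 0 < a₀ ∧ ∀ (K : Type) [Field K] [NumberField K], Module.finrank ℚ K = 3 →
      ∀ (C : ClassGroup (𝓞 K)) (x h : ℝ), ThornerZaman.condQn K ^ a₀ ≤ x → x ^ (1 - δ) ≤ h → h ≤ x →
        h / (16 * (NumberField.classNumber K : ℝ)) ≤
          chebyshevThetaIdealClass K C (x + h) - chebyshevThetaIdealClass K C x :=
  theta_shortInterval_of_odd 3 (by norm_num) (by decide)

/-- **Every ideal class of every CUBIC field contains a prime ideal with norm in every short interval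
`(x, x + h]`, `x ≥ (27|d_K|)^{a₀}`, `x^{1−δ} ≤ h ≤ x`** — the `n = 3` slice of the cell, unconditionally. -/
theorem exists_prime_mem_class_absNorm_mem_Ioc_cubic :
    ∃ δ a₀ : ℝ, 0 < δ ∧ 0 < a₀ ∧ ∀ (K : Type) [Field K] [NumberField K], Module.finrank ℚ K = 3 →
      ∀ (C : ClassGroup (𝓞 K)) (x h : ℝ), ThornerZaman.condQn K ^ a₀ ≤ x → x ^ (1 - δ) ≤ h → h ≤ x →
        ∃ P : Ideal (𝓞 K), P.IsPrime ∧ x < (Ideal.absNorm P : ℝ) ∧ (Ideal.absNorm P : ℝ) ≤ x + h ∧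
          ∃ hP : P ∈ (Ideal (𝓞 K))⁰, ClassGroup.mk0 ⟨P, hP⟩ = C :=
  exists_prime_mem_class_absNorm_mem_Ioc_of_odd 3 (by norm_num) (by decide)

end Summit.QuantumAdvantage.QuantumAdvantage.Theorems.DegreeOnePrimesEscape

end
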